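import Summits.HodgeConjecture.HodgeConjecture.Theorems.H413ChiNFinPin          -- ★ `exists_finCoeff_ne_zero_cm` (hfin at the CM line datum, any compatible continuous `s`)
import Summits.HodgeConjecture.HodgeConjecture.Theorems.H413E2SW2HFinOfCM       -- ★ `integrable_finCoeff_cm` (hF at the CM line datum, any compatible continuous `s`)
import Literature.NumberTheory.Automorphic.Liu2021.ThetaLiftFromLineMajorants    -- ★ (N0) `TW_eq_realDiagonal`, `complexConj_coe_realSubfield`, `coe_realSubfield_ne_zero`
import Literature.NumberTheory.Automorphic.Liu2021.Def411WeilCarriers           -- ★ `TW`, `JW`, `JW_eq`, `isSymm_TW`, `isUnit_det_TW`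
import HarnessLib

/-!
# Crux `H413`, programme P2 — Θ-OCC-GEN road, brick (N2): the FINITE-ADELIC rows `hF` (integrable matrix coefficients) and `hfin` (one non-zero
# Fourier coefficient, for EVERY continuous unitary `χ_f`) of Rallis' letter ∕ brick 7, at the LINE splitting in the T5 spelling `(J_W a, T_W a)`

Cell hodgecm-mathlib (D-0151), FLOOR 0, crux item H413 = stmt-HodgeConjecture-24833; programme P2, sub-line `Cruxes/H413/Lines/F0_P2OccFlatGeneral.lean`
(Θ-OCC-GEN, books #173).  Author F0P2-p06 (g8), (N)-half sub-share (bus 2026-09-01T11:5xZ).  `--supports stmt-HodgeConjecture-24833`.  DEF-FREE,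
theorems only, no `sorry`.

THE POINT.  ★ `ThetaNonvanishing.integrable_finCoeff_cm` (`Theorems/H413E2SW2HFinOfCM`, [Li1992, Thm 2.1 (27)], the `hF` binder of ★
`Li1992.RallisInnerProductFormulaUnitaryDualPairRankOneContCM`) and ★ `ThetaNonvanishing.exists_finCoeff_ne_zero_cm` (`Theorems/H413ChiNFinPin`, [Li1992, §5]
local occupancy: one non-zero finite Fourier coefficient for EVERY continuous unitary character `χ_f` of `U(J_W)(𝔸_{L⁺,f})`, the `hfin` row of ★ brick 7
`thetaLift_charCM_tmul_ne_zero_of_finCoeff_ne_zero`) are proved for ANY compatible continuous splitting `s` — but at the spelling `(diagonal d_W,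
realDiagonal d_W)` of the hermitian line.  The T5 theta datum ★ `lineThetaKernelDatum L N e₁ dV hdV hdV0 μ hμ a hρ` spells the line `(J_W a, T_W a)` with
`T_W a = !![a]` (★ `Def411WeilCarriers.TW ∕ JW`).  As in bricks (N0) ★ `ThetaLiftFromLineMajorants` ∕ (N1) `ThetaLiftFromLineL2Continuity`: state both rows for
VARIABLE `(J_W, T_W)` with the equations `J_W = diagonal d_W`, `T_W = realDiagonal d_W`, `subst`, and read them at `(J_W a, T_W a)` (★ `TW_eq_realDiagonal`,
`JW_eq_diagonal`).

* `integrable_finCoeff_line` ∕ `exists_finCoeff_ne_zero_line` — the two rows for ANY compatible continuous `s` of the line datum at VARIABLE `(J_W, T_W)`;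
* `JW_eq_diagonal` — `J_W a = diagonal (a)`;
* **`integrable_finCoeff_chiSplittingLine_TW`** ∕ **`exists_finCoeff_ne_zero_chiSplittingLine_TW`** — at `s := chiSplittingLine … χ … (T_W a) … (J_W a) (JW_eq …)`,
  every unitary splitting character `χ`; **`integrable_finCoeff_lineThetaKernelDatum`** ∕ **`exists_finCoeff_ne_zero_lineThetaKernelDatum`** — at
  `χ := toHeckeCharacter L μ` (the rows for ★ `lineThetaKernelDatum`).

HONEST LABEL: HC_CM is proved only modulo the 2 remaining named inputs (hLiu418, h413) until rung 0 closes; nothing of print is asserted here.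

## References
* [Li1992] J.-S. Li, J. reine angew. Math. 428 (1992), Thm 2.1 (27) p. 184; §5 p. 206.
* [GelbartRogawski1991] S. Gelbart, J. Rogawski, Invent. Math. 105 (1991), §3.1 Prop. 3.1.1 p. 455, Remark p. 457 L4–13.
* [Liu2021] Y. Liu, Camb. J. Math. 9 (2021) = arXiv:2102.11518, App. D §D.1 Steps 1–3 (l. 5214–5233).
-/

set_option autoImplicit false
set_option linter.dupNamespace false

noncomputable section

open scoped ComplexConjugate Matrix
open MeasureTheory NumberField IsDedekindDomain
open Literature.NumberTheory.Automorphic Literature.NumberTheory.Automorphic.UnitaryGroup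
open Literature.NumberTheory.Automorphic.IdeleClassGroup
open Literature.NumberTheory.Automorphic.Liu2021 Literature.NumberTheory.Automorphic.Liu2021.Def411WeilCarriers
open Literature.NumberTheory.Automorphic.Liu2021.Def411WeilCarriersDoubling
open Literature.NumberTheory.Weil1964
open Literature.NumberTheory.GelbartRogawski1991 Literature.NumberTheory.GelbartRogawski1991.UnitaryDualPair
open Literature.NumberTheory.GelbartRogawski1991.UnitaryDualPair.WeilCoinv
open Literature.NumberTheory.GaloisRepresentations (HeckeCharacter)
open Literature.RepresentationTheory.HarrisKudlaSweet1996 (IsSplittingChar)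
open Literature.RepresentationTheory.Liu2021
open Summit.HodgeConjecture.HodgeConjecture.Cruxes.H413.ThetaNonvanishing

namespace Summit.HodgeConjecture.HodgeConjecture.Cruxes.H413.F0P2tLineFinCoeff

variable (L : Type) [Field L] [NumberField L] [IsCMField L] {N n' : ℕ} (e₁ : Fin N × Fin 1 ≃ Fin n')
  (dV : Fin N → L) (hdV : ∀ i, IsCMField.complexConj L (dV i) = dV i) (hdV0 : ∀ i, dV i ≠ 0) (h3 : 3 ≤ n')

/-! ## §1 The two finite rows for ANY compatible continuous splitting of the line datum at VARIABLE `(J_W, T_W)` -/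

set_option maxHeartbeats 2000000 in
-- heartbeats: two `subst`s through the `splittingDatum` telescope, then ★ `integrable_finCoeff_cm` (itself 2 000 000).
include hdV0 h3 in
/-- **`hF` for ANY compatible continuous splitting of the line datum `(U(diag d_V), U(J_W))` at variable `(J_W, T_W)`**, `J_W = diagonal d_W`,
`T_W = realDiagonal d_W`: the finite matrix coefficients `b ↦ ⟨R_e ω_f^{s}(1,b) R_e⁻¹ Φ_f, Ψ_f⟩_μ` are integrable on `U(J_W)(𝔸_{L⁺,f})` for all `Φ_f, Ψ_f`
(★ `integrable_finCoeff_cm` after `subst`). [cite: Li1992, Thm 2.1 (27) p. 184; §5 p. 206] [cite: GelbartRogawski1991, §3.1 Prop. 3.1.1 p. 455] -/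
theorem integrable_finCoeff_line (dW : Fin 1 → L) (hdW : ∀ i, IsCMField.complexConj L (dW i) = dW i) (hdW0 : ∀ i, dW i ≠ 0)
    (TW : Matrix (Fin 1) (Fin 1) ↥(maximalRealSubfield L)) (hTW : TW = realDiagonal L dW hdW)
    (JW : Matrix (Fin 1) (Fin 1) L) (hJWd : JW = Matrix.diagonal dW)
    (hW : TW.IsSymm) (hWd : IsUnit TW.det) (hJW : JW = TW.map (algebraMap (↥(maximalRealSubfield L)) L))
    {s : UnitaryGroup.adelicPair (↥(maximalRealSubfield L)) L (IsCMField.complexConj L) N 1 (Matrix.diagonal dV) JW →*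
      adelicMpCont (↥(maximalRealSubfield L)) (Fin n') (adelicGram (↥(maximalRealSubfield L)) e₁ (realDiagonal L dV hdV) TW)}
    (hs : (splittingDatum (↥(maximalRealSubfield L)) L (IsCMField.complexConj L) N 1 e₁ (Matrix.diagonal dV) JW
      (complexConj_imagUnit L) (imagUnit_ne_zero L) (imagUnit_mul_self L) (realDiagonal_isSymm L dV hdV) hW
      (isUnit_det_realDiagonal L dV hdV hdV0) hWd (realDiagonal_map L dV hdV).symm hJW).IsCompatible s)
    (hsc : Continuous s)
    [MeasurableSpace (FiniteAdeleRing (𝓞 ↥(maximalRealSubfield L)) ↥(maximalRealSubfield L))]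
    [BorelSpace (FiniteAdeleRing (𝓞 ↥(maximalRealSubfield L)) ↥(maximalRealSubfield L))]
    (μ : Measure (Fin n' → FiniteAdeleRing (𝓞 ↥(maximalRealSubfield L)) ↥(maximalRealSubfield L))) [μ.IsAddHaarMeasure]
    [MeasurableSpace (UnitaryGroup.finAdelic (↥(maximalRealSubfield L)) L (IsCMField.complexConj L) 1 JW)]
    [BorelSpace (UnitaryGroup.finAdelic (↥(maximalRealSubfield L)) L (IsCMField.complexConj L) 1 JW)]
    (μb : Measure (UnitaryGroup.finAdelic (↥(maximalRealSubfield L)) L (IsCMField.complexConj L) 1 JW)) [μb.IsHaarMeasure]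
    (Φf Ψf : FinSB (↥(maximalRealSubfield L)) (Fin n')) :
    Integrable (fun b : UnitaryGroup.finAdelic (↥(maximalRealSubfield L)) L (IsCMField.complexConj L) 1 JW =>
      ∫ y, ((finSBReindex (↥(maximalRealSubfield L)) e₁ (finPairRep (↥(maximalRealSubfield L)) L (IsCMField.complexConj L) N 1 e₁
            (Matrix.diagonal dV) JW (complexConj_imagUnit L) (imagUnit_ne_zero L) (imagUnit_mul_self L) (realDiagonal_isSymm L dV hdV) hW
            (isUnit_det_realDiagonal L dV hdV hdV0) hWd (realDiagonal_map L dV hdV).symm hJW hs (1, b)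
            ((finSBReindex (↥(maximalRealSubfield L)) e₁).symm Φf)) : FinSB (↥(maximalRealSubfield L)) (Fin n')) :
            (Fin n' → FiniteAdeleRing (𝓞 ↥(maximalRealSubfield L)) ↥(maximalRealSubfield L)) → ℂ) y *
        conj ((Ψf : (Fin n' → FiniteAdeleRing (𝓞 ↥(maximalRealSubfield L)) ↥(maximalRealSubfield L)) → ℂ) y) ∂μ) μb := by
  subst hTW
  subst hJWd
  exact integrable_finCoeff_cm L e₁ dV hdV hdV0 dW hdW hdW0 h3 hs hsc μ μb Φf Ψf

set_option maxHeartbeats 2000000 in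
-- heartbeats: as above, over ★ `exists_finCoeff_ne_zero_cm` (2 000 000).
include hdV0 h3 in
/-- **`hfin` for ANY compatible continuous splitting of the line datum at variable `(J_W, T_W)`**, `J_W = diagonal d_W`, `T_W = realDiagonal d_W`, and
EVERY continuous unitary character `χ_f` of `U(J_W)(𝔸_{L⁺,f})`: some `Φ_f ∈ 𝒮((𝔸_{L⁺,f})ⁿ)` has `∫ b, ⟨R_e ω_f^{s}(1,b) R_e⁻¹ Φ_f, Φ_f⟩_μ · conj (χ_f b) ∂μ_f ≠ 0`
(★ `exists_finCoeff_ne_zero_cm` after `subst`: [Li1992, §5] local occupancy at the CM line datum).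
[cite: Li1992, Thm 2.1 (27) p. 184; §5 p. 206] [cite: GelbartRogawski1991, §3.1 Prop. 3.1.1 p. 455, Remark p. 457 L4–13] -/
theorem exists_finCoeff_ne_zero_line (dW : Fin 1 → L) (hdW : ∀ i, IsCMField.complexConj L (dW i) = dW i) (hdW0 : ∀ i, dW i ≠ 0)
    (TW : Matrix (Fin 1) (Fin 1) ↥(maximalRealSubfield L)) (hTW : TW = realDiagonal L dW hdW)
    (JW : Matrix (Fin 1) (Fin 1) L) (hJWd : JW = Matrix.diagonal dW)
    (hW : TW.IsSymm) (hWd : IsUnit TW.det) (hJW : JW = TW.map (algebraMap (↥(maximalRealSubfield L)) L))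
    {s : UnitaryGroup.adelicPair (↥(maximalRealSubfield L)) L (IsCMField.complexConj L) N 1 (Matrix.diagonal dV) JW →*
      adelicMpCont (↥(maximalRealSubfield L)) (Fin n') (adelicGram (↥(maximalRealSubfield L)) e₁ (realDiagonal L dV hdV) TW)}
    (hs : (splittingDatum (↥(maximalRealSubfield L)) L (IsCMField.complexConj L) N 1 e₁ (Matrix.diagonal dV) JW
      (complexConj_imagUnit L) (imagUnit_ne_zero L) (imagUnit_mul_self L) (realDiagonal_isSymm L dV hdV) hW
      (isUnit_det_realDiagonal L dV hdV hdV0) hWd (realDiagonal_map L dV hdV).symm hJW).IsCompatible s)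
    (hsc : Continuous s)
    [MeasurableSpace (FiniteAdeleRing (𝓞 ↥(maximalRealSubfield L)) ↥(maximalRealSubfield L))]
    [BorelSpace (FiniteAdeleRing (𝓞 ↥(maximalRealSubfield L)) ↥(maximalRealSubfield L))]
    (μ : Measure (Fin n' → FiniteAdeleRing (𝓞 ↥(maximalRealSubfield L)) ↥(maximalRealSubfield L))) [μ.IsAddHaarMeasure]
    [MeasurableSpace (UnitaryGroup.finAdelic (↥(maximalRealSubfield L)) L (IsCMField.complexConj L) 1 JW)]
    [BorelSpace (UnitaryGroup.finAdelic (↥(maximalRealSubfield L)) L (IsCMField.complexConj L) 1 JW)]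
    (μf : Measure (UnitaryGroup.finAdelic (↥(maximalRealSubfield L)) L (IsCMField.complexConj L) 1 JW)) [μf.IsHaarMeasure]
    (χf : UnitaryGroup.finAdelic (↥(maximalRealSubfield L)) L (IsCMField.complexConj L) 1 JW →* ℂˣ)
    (hχf : Continuous fun b => ((χf b : ℂˣ) : ℂ)) (hχfu : ∀ b, ‖((χf b : ℂˣ) : ℂ)‖ = 1) :
    ∃ Φf : FinSB (↥(maximalRealSubfield L)) (Fin n'),
      ∫ b, (∫ y, ((finSBReindex (↥(maximalRealSubfield L)) e₁ (finPairRep (↥(maximalRealSubfield L)) L (IsCMField.complexConj L) N 1 e₁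
              (Matrix.diagonal dV) JW (complexConj_imagUnit L) (imagUnit_ne_zero L) (imagUnit_mul_self L) (realDiagonal_isSymm L dV hdV) hW
              (isUnit_det_realDiagonal L dV hdV hdV0) hWd (realDiagonal_map L dV hdV).symm hJW hs (1, b)
              ((finSBReindex (↥(maximalRealSubfield L)) e₁).symm Φf)) : FinSB (↥(maximalRealSubfield L)) (Fin n')) :
              (Fin n' → FiniteAdeleRing (𝓞 ↥(maximalRealSubfield L)) ↥(maximalRealSubfield L)) → ℂ) y *
          conj ((Φf : (Fin n' → FiniteAdeleRing (𝓞 ↥(maximalRealSubfield L)) ↥(maximalRealSubfield L)) → ℂ) y) ∂μ) *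
        conj ((χf b : ℂˣ) : ℂ) ∂μf ≠ 0 := by
  subst hTW
  subst hJWd
  exact exists_finCoeff_ne_zero_cm L e₁ dV hdV hdV0 dW hdW hdW0 h3 hs hsc μ μf χf hχf hχfu

/-! ## §2 The T5 spelling: Gram `T_W a = !![a]`, form `J_W a`, `hJW := JW_eq` -/

omit [NumberField L] [IsCMField L] in
/-- **the two hermitian Gram spellings of the line agree**: `J_W a = diagonal (a)`. [cite: Liu2021, App. D §D.1 Step 1 (l. 5215)] -/
theorem JW_eq_diagonal (a : (↥(maximalRealSubfield L))ˣ) :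
    JW (↥(maximalRealSubfield L)) L a = Matrix.diagonal (fun _ : Fin 1 => ((a : ↥(maximalRealSubfield L)) : L)) := by
  ext i j
  obtain rfl : i = 0 := Subsingleton.elim _ _
  obtain rfl : j = 0 := Subsingleton.elim _ _
  rw [Matrix.diagonal_apply_eq]
  rfl

variable [MeasurableSpace (FiniteAdeleRing (𝓞 ↥(maximalRealSubfield L)) ↥(maximalRealSubfield L))]
  [BorelSpace (FiniteAdeleRing (𝓞 ↥(maximalRealSubfield L)) ↥(maximalRealSubfield L))]
  (μ : Measure (Fin n' → FiniteAdeleRing (𝓞 ↥(maximalRealSubfield L)) ↥(maximalRealSubfield L))) [μ.IsAddHaarMeasure]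
  (a : (↥(maximalRealSubfield L))ˣ)
  [MeasurableSpace (UnitaryGroup.finAdelic (↥(maximalRealSubfield L)) L (IsCMField.complexConj L) 1 (JW (↥(maximalRealSubfield L)) L a))]
  [BorelSpace (UnitaryGroup.finAdelic (↥(maximalRealSubfield L)) L (IsCMField.complexConj L) 1 (JW (↥(maximalRealSubfield L)) L a))]
  (μb : Measure (UnitaryGroup.finAdelic (↥(maximalRealSubfield L)) L (IsCMField.complexConj L) 1 (JW (↥(maximalRealSubfield L)) L a)))
  [μb.IsHaarMeasure]

set_option maxHeartbeats 2000000 in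
include hdV0 h3 in
/-- **`hF` AT THE LINE'S `χ`-SPLITTING, T5 SPELLING** (`s := chiSplittingLine … χ … (T_W a) … (J_W a) (JW_eq …)`, every unitary splitting character `χ`).
[cite: Li1992, Thm 2.1 (27) p. 184; §5 p. 206] [cite: Liu2021, App. D §D.1 Steps 1–2 (l. 5215–5219)] -/
theorem integrable_finCoeff_chiSplittingLine_TW (χ : HeckeCharacter L) (hχu : χ.IsUnitary) (hχs : IsSplittingChar L 1 χ)
    (Φf Ψf : FinSB (↥(maximalRealSubfield L)) (Fin n')) :
    Integrable (fun b : UnitaryGroup.finAdelic (↥(maximalRealSubfield L)) L (IsCMField.complexConj L) 1 (JW (↥(maximalRealSubfield L)) L a) =>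
      ∫ y, ((finSBReindex (↥(maximalRealSubfield L)) e₁ (finPairRep (↥(maximalRealSubfield L)) L (IsCMField.complexConj L) N 1 e₁
            (Matrix.diagonal dV) (JW (↥(maximalRealSubfield L)) L a) (complexConj_imagUnit L) (imagUnit_ne_zero L) (imagUnit_mul_self L)
            (realDiagonal_isSymm L dV hdV) (isSymm_TW (↥(maximalRealSubfield L)) a) (isUnit_det_realDiagonal L dV hdV hdV0)
            (isUnit_det_TW (↥(maximalRealSubfield L)) a) (realDiagonal_map L dV hdV).symm (JW_eq (↥(maximalRealSubfield L)) L a)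
            (isCompatible_chiSplittingLine L e₁ dV hdV hdV0 χ hχu hχs (TW (↥(maximalRealSubfield L)) a) (isSymm_TW (↥(maximalRealSubfield L)) a)
              (isUnit_det_TW (↥(maximalRealSubfield L)) a) (JW (↥(maximalRealSubfield L)) L a) (JW_eq (↥(maximalRealSubfield L)) L a)) (1, b)
            ((finSBReindex (↥(maximalRealSubfield L)) e₁).symm Φf)) : FinSB (↥(maximalRealSubfield L)) (Fin n')) :
            (Fin n' → FiniteAdeleRing (𝓞 ↥(maximalRealSubfield L)) ↥(maximalRealSubfield L)) → ℂ) y *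
        conj ((Ψf : (Fin n' → FiniteAdeleRing (𝓞 ↥(maximalRealSubfield L)) ↥(maximalRealSubfield L)) → ℂ) y) ∂μ) μb :=
  integrable_finCoeff_line L e₁ dV hdV hdV0 h3 _ (complexConj_coe_realSubfield L a) (coe_realSubfield_ne_zero L a)
    (TW (↥(maximalRealSubfield L)) a) (TW_eq_realDiagonal L a) (JW (↥(maximalRealSubfield L)) L a) (JW_eq_diagonal L a)
    (isSymm_TW (↥(maximalRealSubfield L)) a) (isUnit_det_TW (↥(maximalRealSubfield L)) a) (JW_eq (↥(maximalRealSubfield L)) L a)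
    (isCompatible_chiSplittingLine L e₁ dV hdV hdV0 χ hχu hχs _ _ _ _ _)
    (continuous_chiSplittingLine L e₁ dV hdV hdV0 χ hχu hχs _ _ _ _) μ μb Φf Ψf

set_option maxHeartbeats 2000000 in
include hdV0 h3 in
/-- **`hfin` AT THE LINE'S `χ`-SPLITTING, T5 SPELLING, for EVERY continuous unitary `χ_f`** (`s := chiSplittingLine … χ … (T_W a) … (J_W a) (JW_eq …)`).
[cite: Li1992, Thm 2.1 (27) p. 184; §5 p. 206] [cite: Liu2021, App. D §D.1 Steps 1–3 (l. 5214–5233)] -/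
theorem exists_finCoeff_ne_zero_chiSplittingLine_TW (χ : HeckeCharacter L) (hχu : χ.IsUnitary) (hχs : IsSplittingChar L 1 χ)
    (χf : UnitaryGroup.finAdelic (↥(maximalRealSubfield L)) L (IsCMField.complexConj L) 1 (JW (↥(maximalRealSubfield L)) L a) →* ℂˣ)
    (hχf : Continuous fun b => ((χf b : ℂˣ) : ℂ)) (hχfu : ∀ b, ‖((χf b : ℂˣ) : ℂ)‖ = 1) :
    ∃ Φf : FinSB (↥(maximalRealSubfield L)) (Fin n'),
      ∫ b, (∫ y, ((finSBReindex (↥(maximalRealSubfield L)) e₁ (finPairRep (↥(maximalRealSubfield L)) L (IsCMField.complexConj L) N 1 e₁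
              (Matrix.diagonal dV) (JW (↥(maximalRealSubfield L)) L a) (complexConj_imagUnit L) (imagUnit_ne_zero L) (imagUnit_mul_self L)
              (realDiagonal_isSymm L dV hdV) (isSymm_TW (↥(maximalRealSubfield L)) a) (isUnit_det_realDiagonal L dV hdV hdV0)
              (isUnit_det_TW (↥(maximalRealSubfield L)) a) (realDiagonal_map L dV hdV).symm (JW_eq (↥(maximalRealSubfield L)) L a)
              (isCompatible_chiSplittingLine L e₁ dV hdV hdV0 χ hχu hχs (TW (↥(maximalRealSubfield L)) a) (isSymm_TW (↥(maximalRealSubfield L)) a)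
                (isUnit_det_TW (↥(maximalRealSubfield L)) a) (JW (↥(maximalRealSubfield L)) L a) (JW_eq (↥(maximalRealSubfield L)) L a)) (1, b)
              ((finSBReindex (↥(maximalRealSubfield L)) e₁).symm Φf)) : FinSB (↥(maximalRealSubfield L)) (Fin n')) :
              (Fin n' → FiniteAdeleRing (𝓞 ↥(maximalRealSubfield L)) ↥(maximalRealSubfield L)) → ℂ) y *
          conj ((Φf : (Fin n' → FiniteAdeleRing (𝓞 ↥(maximalRealSubfield L)) ↥(maximalRealSubfield L)) → ℂ) y) ∂μ) *
        conj ((χf b : ℂˣ) : ℂ) ∂μb ≠ 0 :=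
  exists_finCoeff_ne_zero_line L e₁ dV hdV hdV0 h3 _ (complexConj_coe_realSubfield L a) (coe_realSubfield_ne_zero L a)
    (TW (↥(maximalRealSubfield L)) a) (TW_eq_realDiagonal L a) (JW (↥(maximalRealSubfield L)) L a) (JW_eq_diagonal L a)
    (isSymm_TW (↥(maximalRealSubfield L)) a) (isUnit_det_TW (↥(maximalRealSubfield L)) a) (JW_eq (↥(maximalRealSubfield L)) L a)
    (isCompatible_chiSplittingLine L e₁ dV hdV hdV0 χ hχu hχs _ _ _ _ _)
    (continuous_chiSplittingLine L e₁ dV hdV hdV0 χ hχu hχs _ _ _ _) μ μb χf hχf hχfu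

set_option maxHeartbeats 2000000 in
include hdV0 h3 in
/-- **the `hF` row of Rallis' letter for ★ `lineThetaKernelDatum L N e₁ dV hdV hdV0 μ hμ a hρ`** (`χ := toHeckeCharacter L μ`).
[cite: Li1992, Thm 2.1 (27) p. 184; §5 p. 206] [cite: Liu2021, App. D §D.1 Steps 1–2 (l. 5215–5219)] -/
theorem integrable_finCoeff_lineThetaKernelDatum (μH : Literature.NumberTheory.Automorphic.IdeleClassGroup L →ₜ* Circle)
    (hμ : IsConjugateSymplectic L μH) (Φf Ψf : FinSB (↥(maximalRealSubfield L)) (Fin n')) :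
    Integrable (fun b : UnitaryGroup.finAdelic (↥(maximalRealSubfield L)) L (IsCMField.complexConj L) 1 (JW (↥(maximalRealSubfield L)) L a) =>
      ∫ y, ((finSBReindex (↥(maximalRealSubfield L)) e₁ (finPairRep (↥(maximalRealSubfield L)) L (IsCMField.complexConj L) N 1 e₁
            (Matrix.diagonal dV) (JW (↥(maximalRealSubfield L)) L a) (complexConj_imagUnit L) (imagUnit_ne_zero L) (imagUnit_mul_self L)
            (realDiagonal_isSymm L dV hdV) (isSymm_TW (↥(maximalRealSubfield L)) a) (isUnit_det_realDiagonal L dV hdV hdV0)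
            (isUnit_det_TW (↥(maximalRealSubfield L)) a) (realDiagonal_map L dV hdV).symm (JW_eq (↥(maximalRealSubfield L)) L a)
            (isCompatible_chiSplittingLine L e₁ dV hdV hdV0 (toHeckeCharacter L μH) (isUnitary_toHeckeCharacter L μH)
              ((isOscillatorChar_toHeckeCharacter_iff μH).mpr hμ) (TW (↥(maximalRealSubfield L)) a) (isSymm_TW (↥(maximalRealSubfield L)) a)
              (isUnit_det_TW (↥(maximalRealSubfield L)) a) (JW (↥(maximalRealSubfield L)) L a) (JW_eq (↥(maximalRealSubfield L)) L a)) (1, b)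
            ((finSBReindex (↥(maximalRealSubfield L)) e₁).symm Φf)) : FinSB (↥(maximalRealSubfield L)) (Fin n')) :
            (Fin n' → FiniteAdeleRing (𝓞 ↥(maximalRealSubfield L)) ↥(maximalRealSubfield L)) → ℂ) y *
        conj ((Ψf : (Fin n' → FiniteAdeleRing (𝓞 ↥(maximalRealSubfield L)) ↥(maximalRealSubfield L)) → ℂ) y) ∂μ) μb :=
  integrable_finCoeff_chiSplittingLine_TW L e₁ dV hdV hdV0 h3 μ a μb (toHeckeCharacter L μH) (isUnitary_toHeckeCharacter L μH)
    ((isOscillatorChar_toHeckeCharacter_iff μH).mpr hμ) Φf Ψf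

set_option maxHeartbeats 2000000 in
include hdV0 h3 in
/-- **the `hfin` row for ★ `lineThetaKernelDatum L N e₁ dV hdV hdV0 μ hμ a hρ`, EVERY continuous unitary `χ_f`** (`χ := toHeckeCharacter L μ`).
[cite: Li1992, Thm 2.1 (27) p. 184; §5 p. 206] [cite: Liu2021, App. D §D.1 Steps 1–3 (l. 5214–5233)] -/
theorem exists_finCoeff_ne_zero_lineThetaKernelDatum (μH : Literature.NumberTheory.Automorphic.IdeleClassGroup L →ₜ* Circle)
    (hμ : IsConjugateSymplectic L μH)
    (χf : UnitaryGroup.finAdelic (↥(maximalRealSubfield L)) L (IsCMField.complexConj L) 1 (JW (↥(maximalRealSubfield L)) L a) →* ℂˣ)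
    (hχf : Continuous fun b => ((χf b : ℂˣ) : ℂ)) (hχfu : ∀ b, ‖((χf b : ℂˣ) : ℂ)‖ = 1) :
    ∃ Φf : FinSB (↥(maximalRealSubfield L)) (Fin n'),
      ∫ b, (∫ y, ((finSBReindex (↥(maximalRealSubfield L)) e₁ (finPairRep (↥(maximalRealSubfield L)) L (IsCMField.complexConj L) N 1 e₁
              (Matrix.diagonal dV) (JW (↥(maximalRealSubfield L)) L a) (complexConj_imagUnit L) (imagUnit_ne_zero L) (imagUnit_mul_self L)
              (realDiagonal_isSymm L dV hdV) (isSymm_TW (↥(maximalRealSubfield L)) a) (isUnit_det_realDiagonal L dV hdV hdV0)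
              (isUnit_det_TW (↥(maximalRealSubfield L)) a) (realDiagonal_map L dV hdV).symm (JW_eq (↥(maximalRealSubfield L)) L a)
              (isCompatible_chiSplittingLine L e₁ dV hdV hdV0 (toHeckeCharacter L μH) (isUnitary_toHeckeCharacter L μH)
                ((isOscillatorChar_toHeckeCharacter_iff μH).mpr hμ) (TW (↥(maximalRealSubfield L)) a) (isSymm_TW (↥(maximalRealSubfield L)) a)
                (isUnit_det_TW (↥(maximalRealSubfield L)) a) (JW (↥(maximalRealSubfield L)) L a) (JW_eq (↥(maximalRealSubfield L)) L a)) (1, b)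
              ((finSBReindex (↥(maximalRealSubfield L)) e₁).symm Φf)) : FinSB (↥(maximalRealSubfield L)) (Fin n')) :
              (Fin n' → FiniteAdeleRing (𝓞 ↥(maximalRealSubfield L)) ↥(maximalRealSubfield L)) → ℂ) y *
          conj ((Φf : (Fin n' → FiniteAdeleRing (𝓞 ↥(maximalRealSubfield L)) ↥(maximalRealSubfield L)) → ℂ) y) ∂μ) *
        conj ((χf b : ℂˣ) : ℂ) ∂μb ≠ 0 :=
  exists_finCoeff_ne_zero_chiSplittingLine_TW L e₁ dV hdV hdV0 h3 μ a μb (toHeckeCharacter L μH) (isUnitary_toHeckeCharacter L μH)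
    ((isOscillatorChar_toHeckeCharacter_iff μH).mpr hμ) χf hχf hχfu

end Summit.HodgeConjecture.HodgeConjecture.Cruxes.H413.F0P2tLineFinCoeff

end
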